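import Literature.Analysis.FunctionSpaces.ItoProcesses
import Literature.Probability.Process.ItoIntegralLocality
import Literature.MeasureTheory.Lebesgue.VitaliSet
import HarnessLib

/-!
# `ito_formula_itoProcess` is false: a counterexample to the mis-stated Itô formula

`Literature/Analysis/FunctionSpaces/ItoProcesses.lean` records Itô's formula for Itô processes
driven by the canonical Brownian motion `B = Literature.Probability.Process.brownian` in the
packaging `Literature.Analysis.FunctionSpaces.ito_formula_itoProcess`, documented there as
**mis-stated**: the interface predicate `Literature.Probability.Process.IsItoIntegral σ B J`
constrains the integrand `σ` only through the approximation mode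
`SimpleProcess.IsApproxSeq`, which is phrased with Mathlib's *lower* Lebesgue integral `∫⁻` and
is therefore blind to a modification of `σ` on a set of times of inner Lebesgue measure zero
(`SimpleProcess.IsApproxSeq.of_forall_measurableSet_subset_null` in that file), whereas the
source requires integrands to be *progressively measurable* (Revuz–Yor, Ch. IV, Def. (2.1),
Def. (2.6)). The corrected statement `ito_formula_itoProcess_of_progressive` is proved in
`ItoFormulaProgressive.lean` (`ito_formula_itoProcess_of_progressive_holds`). This file turns the
counterexample documented in the docstring of `ito_formula_itoProcess_of_progressive` into a
proof of `Literature.Analysis.FunctionSpaces.not_ito_formula_itoProcess : ¬ ito_formula_itoProcess`,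
so that the mis-stated `Prop` can never be discharged or silently assumed. Since the named-fact
verdict clean-up of 2026-08-15 the refuted def is retired from the literature debt
(`@[deprecated]` in `ItoProcesses.lean`, kept verbatim only because this refutation names it), and
`linter.deprecated` is switched off for `not_ito_formula_itoProcess` alone.

**The counterexample.** `X = B` (drift `b = 0`), `f(t, x) = x²`, and the diffusion coefficient
`σ = badDiffusion A`: `σₜ(ω) = 2` if `t ∈ A` and `B_{t+1}(ω) - B_t(ω) > 0`, `σₜ(ω) = 1` otherwise,
where `A ⊆ (0, ∞)` has inner Lebesgue measure zero and is non-null-measurable at every scale near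
`0` (`exists_innerNull_not_nullMeasurableSet_nhds_zero`, a union of Vitali slabs in dyadic
cells). Then `IsItoIntegral σ B B` holds (`isItoIntegral_badDiffusion`): the approximating simple
processes of `σ` are exactly those of the constant `1`, whose Itô integral is `B`
(`Literature.Probability.Process.isItoIntegral_const_brownian`):
* `1 ⇒ σ` (`isApproxSeq_badDiffusion_of_one`) is the blindness of `∫⁻` (`σ ≠ 1` only inside `A`);
* `σ ⇒ 1` (`isApproxSeq_one_of_badDiffusion`) is **non-anticipation**: pathwise
  `∫⁻₀ᵗ (K - 1)² ≤ 16 ∫⁻₀ᵗ (K - σ)² + 2 · Leb{s ≤ t : K(s) > 7/4, B_{s+1} - B_s > 0}`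
  (`lintegral_sub_one_sq_le`) and `Leb{s ≤ t : K(s) > 7/4, B_{s+1} - B_s ≤ 0} ≤ 2 ∫⁻₀ᵗ (K - σ)²`
  (`highNonpos_le_badCost`), while in expectation the two Lebesgue measures compare,
  `E[Leb{K > 7/4, ΔB > 0}] ≤ E[Leb{K > 7/4, ΔB ≤ 0}]` (`lintegral_highPos_le`: Fubini, independence
  of `B_{s+1} - B_s` from the `𝓕⁰_s`-measurable value `K(s)` of an adapted step process, and the
  symmetry `P(ΔB > 0) = P(ΔB < 0)` of the Gaussian increment); bounded convergence in probability
  and Markov's inequality finish (`tendsto_lintegral_highNonpos`, `tendsto_measure_highPos`).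

So `X = B` is an adapted Itô process with coefficients `(0, σ)`, and `ito_formula_itoProcess`
would make `f(t, Bₜ) = Bₜ²` an Itô process with drift `∂ₜf + b ∂ₓf + ½ σ² ∂ₓₓf = σ²`, in
particular with `s ↦ σₛ(ω)²` integrable on `[0, 1]` for almost every `ω`. But on the event
`{B₁ > 0}` (not null: `measure_brownian_one_pos_ne_zero`) continuity gives `δ > 0` with
`B_{s+1} - B_s > 0` for `s < δ`, so `{s : σₛ² = 4} ∩ (0, δ) = A ∩ (0, δ)` would be null-measurable —
contradicting the choice of `A`.

Contents: the multi-scale Vitali set; the forward unit increment `unitIncr` (measurability,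
symmetry, `P(B₁ > 0) ≠ 0`); `badDiffusion` and two pointwise inequalities; for one simple process
the random times `highPos`, `highNonpos`, the cost `badCost` and the three estimates; the limit
arguments; `isItoIntegral_badDiffusion`; the assembly `not_ito_formula_itoProcess`. Auxiliary
objects live in the sub-namespace `Literature.Analysis.FunctionSpaces.ItoFormulaCounterexample`;
the refutation itself is `Literature.Analysis.FunctionSpaces.not_ito_formula_itoProcess`.

## References

* D. Revuz, M. Yor, *Continuous Martingales and Brownian Motion* (3rd ed., 1999), Ch. IV,
  Def. (2.1), Def. (2.6) (integrands are progressively measurable), Def. (2.3), Prop. (2.13),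
  Thm (3.3) and Remark 1°; Ch. I, Thm. (1.9) and Prop. (1.10)(i), (ii) (Gaussian increments,
  independence of `B_{t+s} - B_s` from `σ(B_u, u ≤ s)`, symmetry).
* R. L. Wheeden, A. Zygmund, *Measure and Integral* (1977), Thm. (3.38), Cor. (3.39) (Vitali).
* G. Vitali, *Sul problema della misura dei gruppi di punti di una retta* (1905).
* K. Itô, *On stochastic differential equations*, Mem. Amer. Math. Soc. 4 (1951).
-/


open MeasureTheory ProbabilityTheory Filter
open scoped NNReal ENNReal Topology

noncomputable section

namespace Literature.Analysis.FunctionSpaces.ItoFormulaCounterexample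

open Literature.Probability.Process Literature.Probability.RandomPlanarGeometry

/-! ### A set of inner measure zero which is non-measurable at every scale near `0` -/

/-- **Vitali slabs at every scale.** There is a set `A ⊆ (0, ∞)` of reals all of whose
measurable subsets are Lebesgue-null, such that for every `δ > 0` no set `S` with
`A ∩ (0, δ) ⊆ S ⊆ A` is null-measurable. Construction: in each dyadic cell
`Cₙ = ((1/2)ⁿ⁺¹, (1/2)ⁿ) = B(3 (1/2)ⁿ⁺², (1/2)ⁿ⁺²)` place a Vitali slab `Vₙ` given by
`Literature.MeasureTheory.Lebesgue.Vitali.exists_innerNull_not_nullMeasurableSet` for that ball,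
and let `A = ⋃ₙ (Vₙ ∩ Cₙ)`; a measurable `M ⊆ A` splits along the (pairwise disjoint, Borel)
cells into measurable subsets of the `Vₙ`, and for `(1/2)ⁿ < δ` the trace `S ∩ Cₙ` of a set
squeezed between `A ∩ (0, δ)` and `A` is squeezed between `Vₙ ∩ B` and `Vₙ`.
Wheeden–Zygmund, *Measure and Integral* (1977), Thm. (3.38) and Cor. (3.39) (Vitali 1905).
[cite: WheedenWheedenZygmund1977, Thm. (3.38)–Cor. (3.39)] -/
theorem exists_innerNull_not_nullMeasurableSet_nhds_zero :
    ∃ A : Set ℝ, A ⊆ Set.Ioi 0 ∧ (∀ M : Set ℝ, MeasurableSet M → M ⊆ A → volume M = 0) ∧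
      ∀ δ : ℝ, 0 < δ → ∀ S : Set ℝ, A ∩ Set.Ioo 0 δ ⊆ S → S ⊆ A →
        ¬ NullMeasurableSet S volume := by
  -- dyadic cells `Cₙ = ((1/2)ⁿ⁺¹, (1/2)ⁿ)`, which are the balls `B(cₙ, rₙ)`
  set c : ℕ → ℝ := fun n ↦ 3 * (1 / 2) ^ (n + 2) with hc
  set r : ℕ → ℝ := fun n ↦ (1 / 2) ^ (n + 2) with hr
  have hr0 : ∀ n, 0 < r n := fun n ↦ by positivity
  have hcell : ∀ n, Metric.ball (c n) (r n) = Set.Ioo ((1 / 2 : ℝ) ^ (n + 1)) ((1 / 2) ^ n) := by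
    intro n
    rw [Real.ball_eq_Ioo]
    congr 1 <;> simp only [hc, hr] <;> ring
  have hV := fun n ↦ Literature.MeasureTheory.Lebesgue.Vitali.exists_innerNull_not_nullMeasurableSet
    (volume : Measure ℝ) (ContinuousLinearMap.id ℝ ℝ) (e := 1) rfl (fun x ↦ by simp) (by simp)
    (c n) (hr0 n)
  choose V hVnull hVbig using hV
  -- the cells are pairwise disjoint: membership determines the index
  have hmem : ∀ {m n : ℕ} {x : ℝ}, x ∈ Set.Ioo ((1 / 2 : ℝ) ^ (m + 1)) ((1 / 2) ^ m) →
      x ∈ Set.Ioo ((1 / 2 : ℝ) ^ (n + 1)) ((1 / 2) ^ n) → m = n := by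
    intro m n x hm hn
    by_contra hne
    rcases Nat.lt_or_gt_of_ne hne with h | h
    · have : (1 / 2 : ℝ) ^ n ≤ (1 / 2) ^ (m + 1) :=
        pow_le_pow_of_le_one (by norm_num) (by norm_num) h
      linarith [hm.1, hn.2]
    · have : (1 / 2 : ℝ) ^ m ≤ (1 / 2) ^ (n + 1) :=
        pow_le_pow_of_le_one (by norm_num) (by norm_num) h
      linarith [hn.1, hm.2]
  refine ⟨⋃ n, V n ∩ Set.Ioo ((1 / 2 : ℝ) ^ (n + 1)) ((1 / 2) ^ n), ?_, ?_, ?_⟩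
  · -- positivity
    intro x hx
    simp only [Set.mem_iUnion, Set.mem_inter_iff] at hx
    obtain ⟨n, -, hxn⟩ := hx
    exact lt_trans (by positivity) hxn.1
  · -- inner measure zero
    intro M hM hMA
    have hcov : M ⊆ ⋃ n, M ∩ Set.Ioo ((1 / 2 : ℝ) ^ (n + 1)) ((1 / 2) ^ n) := by
      intro x hx
      have hx' := hMA hx
      simp only [Set.mem_iUnion, Set.mem_inter_iff] at hx' ⊢
      obtain ⟨n, -, hxn⟩ := hx'
      exact ⟨n, hx, hxn⟩
    refine measure_mono_null hcov (measure_iUnion_null fun n ↦ ?_)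
    refine hVnull n _ (hM.inter measurableSet_Ioo) fun x hx ↦ ?_
    have hx' := hMA hx.1
    simp only [Set.mem_iUnion, Set.mem_inter_iff] at hx'
    obtain ⟨k, hxk, hxk'⟩ := hx'
    rwa [hmem hx.2 hxk']
  · -- non-measurability at scale `δ`
    intro δ hδ S hAS hSA hS
    obtain ⟨n, hn⟩ := exists_pow_lt_of_lt_one hδ (by norm_num : (1 / 2 : ℝ) < 1)
    refine hVbig n (S ∩ Set.Ioo ((1 / 2 : ℝ) ^ (n + 1)) ((1 / 2) ^ n)) ?_ ?_
      (hS.inter measurableSet_Ioo.nullMeasurableSet)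
    · intro x hx
      rw [hcell n] at hx
      refine ⟨hAS ⟨Set.mem_iUnion.2 ⟨n, hx⟩, ?_, hx.2.2.trans hn⟩, hx.2⟩
      exact lt_trans (by positivity) hx.2.1
    · intro x hx
      have hx' := hSA hx.1
      simp only [Set.mem_iUnion, Set.mem_inter_iff] at hx'
      obtain ⟨k, hxk, hxk'⟩ := hx'
      rwa [hmem hx.2 hxk']

/-! ### The forward unit increment of Brownian motion -/

/-- The **forward unit increment** `B_{t+1} - B_t` of the canonical Brownian motion (a centred
Gaussian of variance `1`, independent of `σ(B_u, u ≤ t)`).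
Revuz–Yor, *Continuous Martingales and Brownian Motion* (1999), Ch. I, Thm. (1.9) and
Prop. (1.10)(i). [folklore] -/
def unitIncr (t : ℝ≥0) (ω : ℝ≥0 → ℝ) : ℝ := brownian (t + 1) ω - brownian t ω

/-- The forward unit increment at a fixed time is a random variable. [folklore] -/
theorem measurable_unitIncr (t : ℝ≥0) : Measurable (unitIncr t) :=
  (measurable_brownian _).sub (measurable_brownian _)

/-- Joint measurability of `(ω, s) ↦ B_{s⁺}(ω)` (continuous paths, measurable marginals).
[folklore] -/
theorem measurable_brownian_uncurry :
    Measurable fun p : (ℝ≥0 → ℝ) × ℝ ↦ brownian p.2.toNNReal p.1 := by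
  have h : Measurable (Function.uncurry brownian) :=
    measurable_uncurry_of_continuous_of_measurable continuous_brownian measurable_brownian
  exact h.comp ((measurable_real_toNNReal.comp measurable_snd).prodMk measurable_fst)

/-- Joint measurability of `(ω, s) ↦ B_{s⁺+1}(ω) - B_{s⁺}(ω)`. [folklore] -/
theorem measurable_unitIncr_uncurry :
    Measurable fun p : (ℝ≥0 → ℝ) × ℝ ↦ unitIncr p.2.toNNReal p.1 := by
  have h : Measurable (Function.uncurry brownian) :=
    measurable_uncurry_of_continuous_of_measurable continuous_brownian measurable_brownian
  unfold unitIncr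
  refine Measurable.sub ?_ measurable_brownian_uncurry
  exact h.comp (((measurable_real_toNNReal.comp measurable_snd).add_const 1).prodMk measurable_fst)

/-- **Symmetry of the increment**: `P(B_{t+1} - B_t > 0) = P(B_{t+1} - B_t < 0)`, since both
`B_{t+1} - B_t` and `B_t - B_{t+1}` have the law `𝒩(0, 1)` (no density computation is needed).
Revuz–Yor, *Continuous Martingales and Brownian Motion* (1999), Ch. I, Thm. (1.9) (Gaussian
increments) and Prop. (1.10)(ii) (symmetry). [folklore] -/
theorem measure_unitIncr_pos_eq_neg (t : ℝ≥0) :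
    preWienerMeasure {ω | 0 < unitIncr t ω} = preWienerMeasure {ω | unitIncr t ω < 0} := by
  have h1 := (isPreBrownianReal_brownian.hasLaw_sub (t + 1) t).measure_eq
    (p := fun x : ℝ ↦ 0 < x) measurableSet_Ioi
  have h2 := (isPreBrownianReal_brownian.hasLaw_sub t (t + 1)).measure_eq
    (p := fun x : ℝ ↦ 0 < x) measurableSet_Ioi
  rw [nndist_comm] at h2
  have h3 : {ω : ℝ≥0 → ℝ | 0 < (brownian t - brownian (t + 1)) ω} = {ω | unitIncr t ω < 0} := by
    ext ω; simp only [Set.mem_setOf_eq, Pi.sub_apply, unitIncr, sub_pos, sub_neg]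
  rw [← h3, h2, ← h1]
  rfl

/-- Symmetry of the increment, one-sided form: `P(B_{t+1} - B_t > 0) ≤ P(B_{t+1} - B_t ≤ 0)`.
[folklore] -/
theorem measure_unitIncr_pos_le (t : ℝ≥0) :
    preWienerMeasure {ω | 0 < unitIncr t ω} ≤ preWienerMeasure {ω | unitIncr t ω ≤ 0} := by
  rw [measure_unitIncr_pos_eq_neg]
  exact measure_mono fun ω (hω : unitIncr t ω < 0) ↦ hω.le

/-- **`{B₁ > 0}` is not a null event**: otherwise, by symmetry, `B₁ = B₁ - B₀ = 0` a.s.,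
contradicting `E[(B₁ - B₀)²] = 1`.
Revuz–Yor, *Continuous Martingales and Brownian Motion* (1999), Ch. I, Thm. (1.9). [folklore] -/
theorem measure_brownian_one_pos_ne_zero :
    preWienerMeasure {ω | 0 < brownian 1 ω} ≠ 0 := by
  intro h0
  have hpos : preWienerMeasure {ω | 0 < unitIncr 0 ω} = 0 := by
    simpa [unitIncr] using h0
  have hneg : preWienerMeasure {ω | unitIncr 0 ω < 0} = 0 := by
    rwa [← measure_unitIncr_pos_eq_neg]
  have hae : (fun ω ↦ (brownian 1 - brownian 0) ω ^ 2) =ᵐ[preWienerMeasure] 0 := by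
    have hne : preWienerMeasure {ω | unitIncr 0 ω ≠ 0} = 0 := by
      have : {ω : ℝ≥0 → ℝ | unitIncr 0 ω ≠ 0} ⊆
          {ω | 0 < unitIncr 0 ω} ∪ {ω | unitIncr 0 ω < 0} := by
        intro ω hω
        rcases lt_or_gt_of_ne hω with h | h
        · exact Or.inr h
        · exact Or.inl h
      exact measure_mono_null this (by rw [measure_union_null_iff]; exact ⟨hpos, hneg⟩)
    have hae0 : ∀ᵐ ω ∂preWienerMeasure, unitIncr 0 ω = 0 := hne
    filter_upwards [hae0] with ω hω
    simp only [Pi.sub_apply, Pi.zero_apply]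
    simp only [unitIncr, zero_add] at hω
    rw [hω]; ring
  have hint := integral_brownian_sub_sq (zero_le_one (α := ℝ≥0))
  rw [integral_congr_ae hae] at hint
  simp at hint

/-! ### The pathological diffusion coefficient -/

open Classical in
/-- The **pathological diffusion coefficient** `σ` of the counterexample: `σ t ω = 2` if `t ∈ A`
and the forward unit increment `B_{t+1}(ω) - B_t(ω)` is positive, `σ t ω = 1` otherwise. For `A`
of inner measure zero it has the same approximating simple processes as the constant `1`
(`isApproxSeq_badDiffusion_of_one`, `isApproxSeq_one_of_badDiffusion` below), although for `A`
non-measurable its paths are not Lebesgue measurable. [folklore] -/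
def badDiffusion (A : Set ℝ) (t : ℝ≥0) (ω : ℝ≥0 → ℝ) : ℝ :=
  if (t : ℝ) ∈ A ∧ 0 < unitIncr t ω then 2 else 1

/-- Case analysis of the pathological coefficient: it is `1`, or it is `2` at a time of `A` ahead
of a positive unit increment. [folklore] -/
theorem badDiffusion_eq_one_or (A : Set ℝ) (t : ℝ≥0) (ω : ℝ≥0 → ℝ) :
    badDiffusion A t ω = 1 ∨ (badDiffusion A t ω = 2 ∧ (t : ℝ) ∈ A ∧ 0 < unitIncr t ω) := by
  classical
  unfold badDiffusion
  by_cases h : (t : ℝ) ∈ A ∧ 0 < unitIncr t ω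
  · exact Or.inr ⟨by rw [if_pos h], h⟩
  · exact Or.inl (by rw [if_neg h])

/-- Ahead of a non-positive unit increment the pathological coefficient is `1`. [folklore] -/
theorem badDiffusion_of_not_pos (A : Set ℝ) {t : ℝ≥0} {ω : ℝ≥0 → ℝ} (h : ¬ 0 < unitIncr t ω) :
    badDiffusion A t ω = 1 := by
  classical
  unfold badDiffusion
  rw [if_neg (fun h' ↦ h h'.2)]

/-- In real time (through `Real.toNNReal`), the pathological coefficient differs from `1` only
inside `A`, provided `A ⊆ (0, ∞)`. [folklore] -/
theorem mem_of_badDiffusion_ne_one {A : Set ℝ} (hA : A ⊆ Set.Ioi 0) {s : ℝ} {ω : ℝ≥0 → ℝ}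
    (h : badDiffusion A s.toNNReal ω ≠ 1) : s ∈ A := by
  classical
  unfold badDiffusion at h
  by_cases hc : ((s.toNNReal : ℝ≥0) : ℝ) ∈ A ∧ 0 < unitIncr s.toNNReal ω
  · have hs : ((s.toNNReal : ℝ≥0) : ℝ) ∈ A := hc.1
    rcases le_or_gt s 0 with hs0 | hs0
    · rw [Real.toNNReal_of_nonpos hs0] at hs
      exact absurd (hA hs) (by simp)
    · rwa [Real.coe_toNNReal _ hs0.le] at hs
  · rw [if_neg hc] at h
    exact absurd rfl h

/-- **The pointwise estimate** behind `lintegral_sub_one_sq_le`: for a value `k` of a step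
process and `σ ∈ {1, 2}` with `σ = 2` only when `o` holds,
`(k - 1)² ≤ 16 (k - σ)² + 2 · 𝟙{k > 7/4 ∧ o}` (if `σ = 2` and `k ≤ 7/4` then
`16 (k - 2)² - (k - 1)² = 15 k² - 62 k + 63 ≥ 0`). [folklore] -/
theorem sq_sub_one_le {k σ : ℝ} {o : Prop} [Decidable o] (hσ : σ = 1 ∨ (σ = 2 ∧ o)) :
    (k - 1) ^ 2 ≤ 16 * (k - σ) ^ 2 + 2 * (if 7 / 4 < k ∧ o then 1 else 0) := by
  rcases hσ with rfl | ⟨rfl, ho⟩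
  · have : (0 : ℝ) ≤ (if 7 / 4 < k ∧ o then 1 else 0) := by split_ifs <;> norm_num
    nlinarith [sq_nonneg (k - 1)]
  · by_cases hk : 7 / 4 < k
    · rw [if_pos ⟨hk, ho⟩]
      nlinarith [sq_nonneg (k - 3)]
    · rw [if_neg (fun h ↦ hk h.1)]
      push Not at hk
      nlinarith [sq_nonneg (k - 2)]

/-- The pointwise estimate behind `highNonpos_le_badCost`: where `σ = 1` (which is forced by
`¬ o`) and `k > 7/4`, `1 ≤ 2 (k - σ)²`. [folklore] -/
theorem indicator_le_two_mul_sq {k σ : ℝ} {o : Prop} [Decidable o] (hσ : ¬ o → σ = 1) :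
    (if 7 / 4 < k ∧ ¬ o then (1 : ℝ) else 0) ≤ 2 * (k - σ) ^ 2 := by
  split_ifs with h
  · rw [hσ h.2]; nlinarith
  · positivity

/-! ### Pathwise and expected estimates for one simple process -/

section Pathwise

variable (K : SimpleProcess (inferInstance : MeasurableSpace (ℝ≥0 → ℝ)) brownianFiltration)
  (A : Set ℝ) (t : ℝ≥0)

/-- The set of `(ω, s)` at which the step process `K` (read at `s⁺`) exceeds `7/4`. [folklore] -/
def highSet : Set ((ℝ≥0 → ℝ) × ℝ) := {p | 7 / 4 < K.toProcess p.2.toNNReal p.1}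

/-- The set of `(ω, s)` at which the unit increment after `s⁺` is positive. [folklore] -/
def posSet : Set ((ℝ≥0 → ℝ) × ℝ) := {p | 0 < unitIncr p.2.toNNReal p.1}

/-- `highSet K` is jointly measurable (step processes are jointly measurable). [folklore] -/
theorem measurableSet_highSet : MeasurableSet (highSet K) :=
  measurableSet_lt measurable_const K.measurable_toProcess_prod

/-- `posSet` is jointly measurable. [folklore] -/
theorem measurableSet_posSet : MeasurableSet posSet :=
  measurableSet_lt measurable_const measurable_unitIncr_uncurry

/-- `highPos K t ω`: the Lebesgue measure of the times `s ∈ [0, t]` with `K(s) > 7/4` ahead of a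
positive unit increment. [folklore] -/
def highPos (ω : ℝ≥0 → ℝ) : ℝ≥0∞ :=
  volume.restrict (Set.Icc (0 : ℝ) t) (Prod.mk ω ⁻¹' (highSet K ∩ posSet))

/-- `highNonpos K t ω`: the Lebesgue measure of the times `s ∈ [0, t]` with `K(s) > 7/4` ahead of
a non-positive unit increment. [folklore] -/
def highNonpos (ω : ℝ≥0 → ℝ) : ℝ≥0∞ :=
  volume.restrict (Set.Icc (0 : ℝ) t) (Prod.mk ω ⁻¹' (highSet K ∩ posSetᶜ))

/-- `badCost K A t ω = ∫⁻₀ᵗ (K - badDiffusion A)²`: the approximation cost of `K` against the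
pathological coefficient, exactly the quantity controlled by `SimpleProcess.IsApproxSeq`.
[folklore] -/
def badCost (ω : ℝ≥0 → ℝ) : ℝ≥0∞ :=
  ∫⁻ s in Set.Icc (0 : ℝ) t,
    ENNReal.ofReal ((K.toProcess s.toNNReal ω - badDiffusion A s.toNNReal ω) ^ 2)

/-- `highPos K t` is a random variable (sections of a measurable set, s-finite kernel).
[folklore] -/
theorem measurable_highPos : Measurable (highPos K t) :=
  measurable_measure_prodMk_left ((measurableSet_highSet K).inter measurableSet_posSet)

/-- `highNonpos K t` is a random variable. [folklore] -/
theorem measurable_highNonpos : Measurable (highNonpos K t) :=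
  measurable_measure_prodMk_left ((measurableSet_highSet K).inter measurableSet_posSet.compl)

/-- **Pathwise estimate I**: `∫⁻₀ᵗ (K - 1)² ≤ 16 · badCost K A t + 2 · highPos K t`, by
integrating `sq_sub_one_le` (only the indicator summand needs to be measurable for the lower
integral to split). [folklore] -/
theorem lintegral_sub_one_sq_le (ω : ℝ≥0 → ℝ) :
    ∫⁻ s in Set.Icc (0 : ℝ) t, ENNReal.ofReal ((K.toProcess s.toNNReal ω - 1) ^ 2) ≤
      16 * badCost K A t ω + 2 * highPos K t ω := by
  classical
  have hS : MeasurableSet (Prod.mk ω ⁻¹' (highSet K ∩ posSet)) :=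
    measurable_prodMk_left ((measurableSet_highSet K).inter measurableSet_posSet)
  have hpt : ∀ s : ℝ, ENNReal.ofReal ((K.toProcess s.toNNReal ω - 1) ^ 2) ≤
      16 * ENNReal.ofReal ((K.toProcess s.toNNReal ω - badDiffusion A s.toNNReal ω) ^ 2) +
        2 * (Prod.mk ω ⁻¹' (highSet K ∩ posSet)).indicator 1 s := by
    intro s
    have hσ : badDiffusion A s.toNNReal ω = 1 ∨
        (badDiffusion A s.toNNReal ω = 2 ∧ 0 < unitIncr s.toNNReal ω) := by
      rcases badDiffusion_eq_one_or A s.toNNReal ω with h | h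
      · exact Or.inl h
      · exact Or.inr ⟨h.1, h.2.2⟩
    have h1 := sq_sub_one_le (k := K.toProcess s.toNNReal ω) hσ
    have hind : ((Prod.mk ω ⁻¹' (highSet K ∩ posSet)).indicator 1 s : ℝ≥0∞) =
        ENNReal.ofReal (if 7 / 4 < K.toProcess s.toNNReal ω ∧ 0 < unitIncr s.toNNReal ω
          then 1 else 0) := by
      by_cases h : 7 / 4 < K.toProcess s.toNNReal ω ∧ 0 < unitIncr s.toNNReal ω
      · rw [if_pos h, Set.indicator_of_mem (show s ∈ Prod.mk ω ⁻¹' (highSet K ∩ posSet) from h)]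
        simp
      · rw [if_neg h,
          Set.indicator_of_notMem (show s ∉ Prod.mk ω ⁻¹' (highSet K ∩ posSet) from h)]
        simp
    rw [hind]
    calc ENNReal.ofReal ((K.toProcess s.toNNReal ω - 1) ^ 2)
        ≤ ENNReal.ofReal (16 * (K.toProcess s.toNNReal ω - badDiffusion A s.toNNReal ω) ^ 2 +
            2 * (if 7 / 4 < K.toProcess s.toNNReal ω ∧ 0 < unitIncr s.toNNReal ω
              then 1 else 0)) := ENNReal.ofReal_le_ofReal h1
      _ = _ := by
        rw [ENNReal.ofReal_add (by positivity) (by split_ifs <;> norm_num),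
          ENNReal.ofReal_mul (by norm_num), ENNReal.ofReal_mul (by norm_num)]
        norm_num
  calc ∫⁻ s in Set.Icc (0 : ℝ) t, ENNReal.ofReal ((K.toProcess s.toNNReal ω - 1) ^ 2)
      ≤ ∫⁻ s in Set.Icc (0 : ℝ) t,
          (16 * ENNReal.ofReal ((K.toProcess s.toNNReal ω - badDiffusion A s.toNNReal ω) ^ 2) +
          2 * (Prod.mk ω ⁻¹' (highSet K ∩ posSet)).indicator 1 s) := lintegral_mono hpt
    _ = 16 * badCost K A t ω + 2 * highPos K t ω := by
        have hg : Measurable fun s : ℝ ↦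
            (2 : ℝ≥0∞) * (Prod.mk ω ⁻¹' (highSet K ∩ posSet)).indicator 1 s :=
          (measurable_one.indicator hS).const_mul 2
        rw [lintegral_add_right _ hg,
          lintegral_const_mul' _ _ (by norm_num), lintegral_const_mul' _ _ (by norm_num),
          lintegral_indicator_one hS]
        rfl

/-- **Pathwise estimate II**: `highNonpos K t ≤ 2 · badCost K A t` — ahead of a non-positive
increment the coefficient is `1`, so `K > 7/4` costs at least `(3/4)² ≥ 1/2` per unit time.
[folklore] -/
theorem highNonpos_le_badCost (ω : ℝ≥0 → ℝ) : highNonpos K t ω ≤ 2 * badCost K A t ω := by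
  classical
  have hS : MeasurableSet (Prod.mk ω ⁻¹' (highSet K ∩ posSetᶜ)) :=
    measurable_prodMk_left ((measurableSet_highSet K).inter measurableSet_posSet.compl)
  unfold highNonpos badCost
  rw [← lintegral_indicator_one hS, ← lintegral_const_mul' _ _ (by norm_num)]
  refine lintegral_mono fun s ↦ ?_
  have h1 := indicator_le_two_mul_sq (k := K.toProcess s.toNNReal ω)
    (o := 0 < unitIncr s.toNNReal ω) (σ := badDiffusion A s.toNNReal ω)
    (badDiffusion_of_not_pos A)
  by_cases h : 7 / 4 < K.toProcess s.toNNReal ω ∧ ¬ 0 < unitIncr s.toNNReal ω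
  · rw [if_pos h] at h1
    rw [Set.indicator_of_mem (show s ∈ Prod.mk ω ⁻¹' (highSet K ∩ posSetᶜ) from h)]
    simp only [Pi.one_apply]
    rw [← ENNReal.ofReal_one, ← ENNReal.ofReal_ofNat, ← ENNReal.ofReal_mul (by norm_num)]
    exact ENNReal.ofReal_le_ofReal h1
  · rw [Set.indicator_of_notMem (show s ∉ Prod.mk ω ⁻¹' (highSet K ∩ posSetᶜ) from h)]
    exact bot_le

/-- `highNonpos K t ≤ t` (a subset of `[0, t]`). [folklore] -/
theorem highNonpos_le (ω : ℝ≥0 → ℝ) : highNonpos K t ω ≤ t := by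
  unfold highNonpos
  refine (measure_mono (Set.subset_univ _)).trans ?_
  rw [Measure.restrict_apply_univ, Real.volume_Icc, sub_zero, ENNReal.ofReal_coe_nnreal]

/-- **Non-anticipation**: `E[highPos K t] ≤ E[highNonpos K t]`. By Fubini both sides are time
integrals over `s ∈ [0, t]` of `P(K(s) > 7/4, ± (B_{s+1} - B_s) > 0)`; the value `K(s)` of the
adapted step process is `𝓕⁰_s`-measurable, hence independent of the increment `B_{s+1} - B_s`
(`indepFun_of_measurable_brownianFiltration`), and `P(B_{s+1} - B_s > 0) ≤ P(B_{s+1} - B_s ≤ 0)`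
by symmetry.
Revuz–Yor, *Continuous Martingales and Brownian Motion* (1999), Ch. I, Prop. (1.10)(i), (ii)
(independence of `B_{t+s} - B_s` from `σ(B_u, u ≤ s)`; symmetry); Ch. IV, Def. (2.3)
(elementary processes are adapted step processes). [folklore] -/
theorem lintegral_highPos_le :
    ∫⁻ ω, highPos K t ω ∂preWienerMeasure ≤ ∫⁻ ω, highNonpos K t ω ∂preWienerMeasure := by
  haveI := isProbabilityMeasure_preWienerMeasure'
  have hS1 : MeasurableSet (highSet K ∩ posSet) :=
    (measurableSet_highSet K).inter measurableSet_posSet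
  have hS2 : MeasurableSet (highSet K ∩ posSetᶜ) :=
    (measurableSet_highSet K).inter measurableSet_posSet.compl
  unfold highPos highNonpos
  rw [← Measure.prod_apply hS1, ← Measure.prod_apply hS2, Measure.prod_apply_symm hS1,
    Measure.prod_apply_symm hS2]
  refine lintegral_mono fun s ↦ ?_
  -- independence of `K(s⁺)` (which is `𝓕⁰_{s⁺}`-measurable) from the increment after `s⁺`
  set u : ℝ≥0 := s.toNNReal
  have hY : Measurable[brownianFiltration u] (fun ω ↦ K.toProcess u ω) :=
    (K.stronglyMeasurable_toProcess_of_forall u u (fun _ _ h ↦ h.le)).measurable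
  have hind := indepFun_of_measurable_brownianFiltration (le_self_add : u ≤ u + 1) hY
  have heq1 : (fun ω ↦ (ω, s)) ⁻¹' (highSet K ∩ posSet) =
      (fun ω ↦ K.toProcess u ω) ⁻¹' Set.Ioi (7 / 4) ∩
        (brownian (u + 1) - brownian u) ⁻¹' Set.Ioi 0 := by
    ext ω; simp [highSet, posSet, unitIncr, u]
  have heq2 : (fun ω ↦ (ω, s)) ⁻¹' (highSet K ∩ posSetᶜ) =
      (fun ω ↦ K.toProcess u ω) ⁻¹' Set.Ioi (7 / 4) ∩
        (brownian (u + 1) - brownian u) ⁻¹' Set.Iic 0 := by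
    ext ω; simp [highSet, posSet, unitIncr, u]
  rw [heq1, heq2, hind.measure_inter_preimage_eq_mul _ _ measurableSet_Ioi measurableSet_Ioi,
    hind.measure_inter_preimage_eq_mul _ _ measurableSet_Ioi measurableSet_Iic]
  have h3 : preWienerMeasure ((brownian (u + 1) - brownian u) ⁻¹' Set.Ioi 0) ≤
      preWienerMeasure ((brownian (u + 1) - brownian u) ⁻¹' Set.Iic 0) :=
    measure_unitIncr_pos_le u
  exact mul_le_mul' le_rfl h3

end Pathwise

/-! ### The approximating sequences of `badDiffusion A` are those of the constant `1` -/

section Approx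

variable (A : Set ℝ)

/-- **`E[highNonpos Kₙ t] → 0`** along an approximating sequence `Kₙ` of `badDiffusion A`:
`highNonpos ≤ min(t, 2 · badCost)`, and `badCost Kₙ A t → 0` in (outer) probability, so the
expectations of the bounded measurable minorants `highNonpos Kₙ t` tend to `0`. [folklore] -/
theorem tendsto_lintegral_highNonpos
    {Kn : ℕ → SimpleProcess (inferInstance : MeasurableSpace (ℝ≥0 → ℝ)) brownianFiltration}
    (h : SimpleProcess.IsApproxSeq Kn (badDiffusion A) preWienerMeasure) (t : ℝ≥0) :
    Tendsto (fun n ↦ ∫⁻ ω, highNonpos (Kn n) t ω ∂preWienerMeasure) atTop (𝓝 0) := by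
  haveI := isProbabilityMeasure_preWienerMeasure'
  rw [ENNReal.tendsto_nhds_zero]
  intro δ hδ
  rcases eq_or_ne δ ∞ with rfl | hδtop
  · exact Eventually.of_forall fun n ↦ le_top
  set η : ℝ := δ.toReal / 4 with hη
  have hηpos : 0 < η := by
    have := ENNReal.toReal_pos hδ.ne' hδtop
    positivity
  have h2η : ENNReal.ofReal (2 * η) = δ / 2 := by
    rw [hη, show 2 * (δ.toReal / 4) = δ.toReal / 2 by ring,
      ENNReal.ofReal_div_of_pos two_pos, ENNReal.ofReal_toReal hδtop, ENNReal.ofReal_ofNat]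
  have hmeas : ∀ n, MeasurableSet {ω | ENNReal.ofReal (2 * η) ≤ highNonpos (Kn n) t ω} :=
    fun n ↦ measurableSet_le measurable_const (measurable_highNonpos (Kn n) t)
  have hpt : ∀ n ω, highNonpos (Kn n) t ω ≤ ENNReal.ofReal (2 * η) +
      (t : ℝ≥0∞) * {ω | ENNReal.ofReal (2 * η) ≤ highNonpos (Kn n) t ω}.indicator 1 ω := by
    intro n ω
    by_cases hω : ENNReal.ofReal (2 * η) ≤ highNonpos (Kn n) t ω
    · rw [Set.indicator_of_mem
        (show ω ∈ {ω' | ENNReal.ofReal (2 * η) ≤ highNonpos (Kn n) t ω'} from hω),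
        Pi.one_apply, mul_one]
      exact (highNonpos_le (Kn n) t ω).trans le_add_self
    · rw [Set.indicator_of_notMem
        (show ω ∉ {ω' | ENNReal.ofReal (2 * η) ≤ highNonpos (Kn n) t ω'} from hω),
        mul_zero, add_zero]
      exact (not_le.1 hω).le
  have hsub : ∀ n, {ω | ENNReal.ofReal (2 * η) ≤ highNonpos (Kn n) t ω} ⊆
      {ω | ENNReal.ofReal η ≤ badCost (Kn n) A t ω} := by
    intro n ω hω
    have h1 := le_trans hω (highNonpos_le_badCost (Kn n) A t ω)
    rw [ENNReal.ofReal_mul zero_le_two, ENNReal.ofReal_ofNat] at h1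
    exact (ENNReal.mul_le_mul_iff_right two_ne_zero ENNReal.ofNat_ne_top).1 h1
  have hlim : Tendsto (fun n ↦ (t : ℝ≥0∞) *
      preWienerMeasure {ω | ENNReal.ofReal η ≤ badCost (Kn n) A t ω}) atTop
      (𝓝 ((t : ℝ≥0∞) * 0)) :=
    ENNReal.Tendsto.const_mul (h t η hηpos) (Or.inr ENNReal.coe_ne_top)
  rw [mul_zero, ENNReal.tendsto_nhds_zero] at hlim
  have hδ2 : 0 < δ / 2 := by simpa using hδ.ne'
  filter_upwards [hlim (δ / 2) hδ2] with n hn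
  calc ∫⁻ ω, highNonpos (Kn n) t ω ∂preWienerMeasure
      ≤ ∫⁻ ω, (ENNReal.ofReal (2 * η) +
          (t : ℝ≥0∞) * {ω | ENNReal.ofReal (2 * η) ≤ highNonpos (Kn n) t ω}.indicator 1 ω)
          ∂preWienerMeasure := lintegral_mono (hpt n)
    _ = ENNReal.ofReal (2 * η) +
          (t : ℝ≥0∞) * preWienerMeasure {ω | ENNReal.ofReal (2 * η) ≤ highNonpos (Kn n) t ω} := by
        rw [lintegral_add_left measurable_const, lintegral_const, measure_univ, mul_one,
          lintegral_const_mul _ (measurable_one.indicator (hmeas n)),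
          lintegral_indicator_one (hmeas n)]
    _ ≤ ENNReal.ofReal (2 * η) +
          (t : ℝ≥0∞) * preWienerMeasure {ω | ENNReal.ofReal η ≤ badCost (Kn n) A t ω} :=
        add_le_add le_rfl (mul_le_mul' le_rfl (measure_mono (hsub n)))
    _ ≤ δ / 2 + δ / 2 := by rw [h2η]; exact add_le_add le_rfl hn
    _ = δ := ENNReal.add_halves δ

/-- **`P(highPos Kₙ t ≥ c) → 0`** along an approximating sequence of `badDiffusion A`:
`E[highPos] ≤ E[highNonpos] → 0` (non-anticipation) and Markov's inequality. [folklore] -/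
theorem tendsto_measure_highPos
    {Kn : ℕ → SimpleProcess (inferInstance : MeasurableSpace (ℝ≥0 → ℝ)) brownianFiltration}
    (h : SimpleProcess.IsApproxSeq Kn (badDiffusion A) preWienerMeasure) (t : ℝ≥0)
    {c : ℝ≥0∞} (hc : c ≠ 0) (hc' : c ≠ ∞) :
    Tendsto (fun n ↦ preWienerMeasure {ω | c ≤ highPos (Kn n) t ω}) atTop (𝓝 0) := by
  have h1 : Tendsto (fun n ↦ ∫⁻ ω, highPos (Kn n) t ω ∂preWienerMeasure) atTop (𝓝 0) :=
    tendsto_of_tendsto_of_tendsto_of_le_of_le tendsto_const_nhds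
      (tendsto_lintegral_highNonpos A h t) (fun n ↦ bot_le) fun n ↦ lintegral_highPos_le (Kn n) t
  have h2 : Tendsto (fun n ↦ (∫⁻ ω, highPos (Kn n) t ω ∂preWienerMeasure) / c) atTop (𝓝 0) := by
    simpa [ENNReal.zero_div] using ENNReal.Tendsto.div_const h1 (Or.inr hc)
  refine tendsto_of_tendsto_of_tendsto_of_le_of_le tendsto_const_nhds h2 (fun n ↦ bot_le)
    fun n ↦ ?_
  exact meas_ge_le_lintegral_div (measurable_highPos (Kn n) t).aemeasurable hc hc'

/-- **An approximating sequence of `badDiffusion A` approximates the constant `1`**: from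
`∫⁻₀ᵗ (Kₙ - 1)² ≤ 16 · badCost Kₙ A t + 2 · highPos Kₙ t`, both terms being small in probability.
Revuz–Yor, *Continuous Martingales and Brownian Motion* (1999), Ch. IV, Prop. (2.13)
(the approximation mode). [folklore] -/
theorem isApproxSeq_one_of_badDiffusion
    {Kn : ℕ → SimpleProcess (inferInstance : MeasurableSpace (ℝ≥0 → ℝ)) brownianFiltration}
    (h : SimpleProcess.IsApproxSeq Kn (badDiffusion A) preWienerMeasure) :
    SimpleProcess.IsApproxSeq Kn (fun _ _ ↦ (1 : ℝ)) preWienerMeasure := by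
  intro t ε hε
  have hc0 : ENNReal.ofReal (ε / 4) ≠ 0 := by
    rw [ne_eq, ENNReal.ofReal_eq_zero, not_le]; positivity
  have hG := tendsto_measure_highPos A h t hc0 ENNReal.ofReal_ne_top
  have hC := h t (ε / 32) (by positivity)
  refine tendsto_of_tendsto_of_tendsto_of_le_of_le tendsto_const_nhds
    (by simpa using hC.add hG) (fun n ↦ bot_le) fun n ↦ ?_
  refine (measure_mono fun ω hω ↦ ?_).trans (measure_union_le _ _)
  by_contra hcon
  simp only [Set.mem_union, Set.mem_setOf_eq, not_or, not_le] at hcon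
  have h1 := lintegral_sub_one_sq_le (Kn n) A t ω
  have h2 : 16 * badCost (Kn n) A t ω + 2 * highPos (Kn n) t ω < ENNReal.ofReal ε := by
    calc 16 * badCost (Kn n) A t ω + 2 * highPos (Kn n) t ω
        < 16 * ENNReal.ofReal (ε / 32) + 2 * ENNReal.ofReal (ε / 4) :=
          ENNReal.add_lt_add (ENNReal.mul_lt_mul_right (by norm_num) (by norm_num) hcon.1)
            (ENNReal.mul_lt_mul_right (by norm_num) (by norm_num) hcon.2)
      _ = ENNReal.ofReal ε := by
          rw [← ENNReal.ofReal_ofNat 16, ← ENNReal.ofReal_ofNat 2,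
            ← ENNReal.ofReal_mul (by norm_num), ← ENNReal.ofReal_mul (by norm_num),
            ← ENNReal.ofReal_add (by positivity) (by positivity)]
          congr 1; ring
  exact absurd (le_trans hω h1) (not_le.2 h2)

/-- **Blindness of `∫⁻`**: an approximating sequence of the constant `1` approximates
`badDiffusion A` when `A ⊆ (0, ∞)` has inner measure zero (the two integrands differ only at
times in `A`; `SimpleProcess.IsApproxSeq.of_forall_measurableSet_subset_null`). [folklore] -/
theorem isApproxSeq_badDiffusion_of_one (hA0 : A ⊆ Set.Ioi 0)
    (hAnull : ∀ M : Set ℝ, MeasurableSet M → M ⊆ A → volume M = 0)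
    {Kn : ℕ → SimpleProcess (inferInstance : MeasurableSpace (ℝ≥0 → ℝ)) brownianFiltration}
    (h : SimpleProcess.IsApproxSeq Kn (fun _ _ ↦ (1 : ℝ)) preWienerMeasure) :
    SimpleProcess.IsApproxSeq Kn (badDiffusion A) preWienerMeasure :=
  h.of_forall_measurableSet_subset_null (fun _ ↦ measurable_const) fun _ M hM hMsub ↦
    hAnull M hM fun _ hs ↦ mem_of_badDiffusion_ne_one hA0 (hMsub hs).symm

/-- **`IsItoIntegral (badDiffusion A) B B`**: for `A ⊆ (0, ∞)` of inner measure zero the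
pathological coefficient has the same approximating sequences as the constant `1`
(`isApproxSeq_badDiffusion_of_one`, `isApproxSeq_one_of_badDiffusion`), whose Itô integral
against the canonical Brownian motion is `B` (`isItoIntegral_const_brownian 1`). [folklore] -/
theorem isItoIntegral_badDiffusion (hA0 : A ⊆ Set.Ioi 0)
    (hAnull : ∀ M : Set ℝ, MeasurableSet M → M ⊆ A → volume M = 0) :
    IsItoIntegral (badDiffusion A) brownian brownian brownianFiltration preWienerMeasure := by
  have h1 := isItoIntegral_const_brownian 1
  simp only [one_mul] at h1
  obtain ⟨h0, hc, hm, ⟨Ln, hLn⟩, hall⟩ := h1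
  exact ⟨h0, hc, hm, ⟨Ln, isApproxSeq_badDiffusion_of_one A hA0 hAnull hLn⟩,
    fun Kn hKn ↦ hall Kn (isApproxSeq_one_of_badDiffusion A hKn)⟩

end Approx

/-! ### Assembly -/

/-- `(x²)'' = 2`, in Mathlib's `iteratedDeriv` form used by `ito_formula_itoProcess`. [folklore] -/
theorem iteratedDeriv_two_sq (y : ℝ) : iteratedDeriv 2 (fun x : ℝ ↦ x ^ 2) y = 2 := by
  have h1 : deriv (fun x : ℝ ↦ x ^ 2) = fun x ↦ 2 * x := by
    funext x; simp
  rw [iteratedDeriv_succ, iteratedDeriv_one, h1]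
  simp

end Literature.Analysis.FunctionSpaces.ItoFormulaCounterexample

namespace Literature.Analysis.FunctionSpaces

open Literature.Probability.Process Literature.Probability.RandomPlanarGeometry
open Literature.Analysis.FunctionSpaces.ItoFormulaCounterexample

-- `ito_formula_itoProcess` is `@[deprecated]` (refuted as stated; named-fact verdict clean-up
-- 2026-08-15) and its refutation must name it; REMOVE-WHEN the deprecated def is deleted.
set_option linter.deprecated false in
/-- **The mis-stated Itô formula `ito_formula_itoProcess` is false.** With `A ⊆ (0, ∞)` of inner
measure zero and non-null-measurable at every scale near `0`
(`exists_innerNull_not_nullMeasurableSet_nhds_zero`), the canonical Brownian motion `B` is an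
adapted Itô process with drift `0` and diffusion coefficient `σ = badDiffusion A`
(`isItoIntegral_badDiffusion`: `IsItoIntegral σ B B`), so `ito_formula_itoProcess` applied to
`f(t, x) = x²` asserts that almost surely `s ↦ ½ σₛ² · 2` is integrable on every `[0, t]`; on the
non-null event `{B₁ > 0}` this fails at `t = 1`, since there `σₛ² = 4` exactly for `s ∈ A` as long
as `B_{s+1} - B_s > 0`, which holds on some `(0, δ)`, and `A ∩ (0, δ)` is not null-measurable. The
statement as printed in the source (progressively measurable integrands) is
`ito_formula_itoProcess_of_progressive`, proved in `ItoFormulaProgressive.lean`.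
Revuz–Yor, *Continuous Martingales and Brownian Motion* (1999), Ch. IV, Thm (3.3) and
Remark 1°, Def. (2.1), Def. (2.6). [folklore] -/
theorem not_ito_formula_itoProcess : ¬ ito_formula_itoProcess := by
  intro h
  obtain ⟨A, hA0, hAnull, hAbig⟩ := exists_innerNull_not_nullMeasurableSet_nhds_zero
  have hX : IsItoProcess brownian 0 (badDiffusion A) brownian brownianFiltration
      preWienerMeasure := by
    refine ⟨ae_of_all _ fun ω t ↦ integrableOn_zero, brownian,
      isItoIntegral_badDiffusion A hA0 hAnull, ae_of_all _ fun ω t ↦ ?_⟩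
    simp
  have hf : ContDiff ℝ 2 (Function.uncurry fun (_ : ℝ) (x : ℝ) ↦ x ^ 2) := by
    have : (Function.uncurry fun (_ : ℝ) (x : ℝ) ↦ x ^ 2) = fun p : ℝ × ℝ ↦ p.2 ^ 2 := by
      funext p; rfl
    rw [this]
    exact contDiff_snd.pow 2
  have hconc := (h (fun (_ : ℝ) (x : ℝ) ↦ x ^ 2) hf adapted_brownian hX).1
  simp only [deriv_const, Pi.zero_apply, zero_mul, add_zero, zero_add,
    iteratedDeriv_two_sq] at hconc
  -- the failure event `{B₁ > 0}`
  have hfail : ∀ ω : ℝ≥0 → ℝ, 0 < brownian 1 ω →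
      ¬ ∀ t : ℝ≥0, IntegrableOn (fun s : ℝ ↦ 2⁻¹ * badDiffusion A s.toNNReal ω ^ 2 * 2)
        (Set.Icc 0 t) := by
    intro ω hω hint
    -- positivity of the unit increment near time `0`
    have hcont : Continuous fun s : ℝ≥0 ↦ unitIncr s ω :=
      ((continuous_brownian ω).comp (continuous_id.add continuous_const)).sub
        (continuous_brownian ω)
    have h0 : 0 < unitIncr 0 ω := by simpa [unitIncr] using hω
    have hev : ∀ᶠ s in 𝓝 (0 : ℝ≥0), 0 < unitIncr s ω :=
      (hcont.tendsto 0).eventually (lt_mem_nhds h0)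
    obtain ⟨ε, hε, hball⟩ := Metric.eventually_nhds_iff.1 hev
    set δ : ℝ := min ε 1 with hδ
    have hδpos : 0 < δ := lt_min hε one_pos
    have hincr : ∀ s ∈ Set.Ioo (0 : ℝ) δ, 0 < unitIncr s.toNNReal ω := by
      intro s hs
      refine hball ?_
      rw [NNReal.dist_eq, NNReal.coe_zero, Real.coe_toNNReal _ hs.1.le, sub_zero,
        abs_of_pos hs.1]
      exact hs.2.trans_le (min_le_left _ _)
    -- the drift on `(0, δ)` is `4` exactly on `A`
    have hS : (fun s : ℝ ↦ 2⁻¹ * badDiffusion A s.toNNReal ω ^ 2 * 2) ⁻¹' {4} ∩ Set.Ioo 0 δ =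
        A ∩ Set.Ioo 0 δ := by
      ext s
      simp only [Set.mem_inter_iff, Set.mem_preimage, Set.mem_singleton_iff, and_congr_left_iff]
      intro hs
      have hs' : ((s.toNNReal : ℝ≥0) : ℝ) = s := Real.coe_toNNReal _ hs.1.le
      classical
      unfold badDiffusion
      rw [hs']
      by_cases hA : s ∈ A
      · rw [if_pos ⟨hA, hincr s hs⟩]; norm_num; exact hA
      · rw [if_neg (fun h' ↦ hA h'.1)]; norm_num; exact hA
    have h1 := hint 1
    have hnm : NullMeasurableSet
        ((fun s : ℝ ↦ 2⁻¹ * badDiffusion A s.toNNReal ω ^ 2 * 2) ⁻¹' {4} ∩ Set.Ioo 0 δ)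
        (volume.restrict (Set.Icc (0 : ℝ) (1 : ℝ≥0))) :=
      (h1.aestronglyMeasurable.aemeasurable.nullMeasurable (measurableSet_singleton 4)).inter
        measurableSet_Ioo.nullMeasurableSet
    rw [hS] at hnm
    have hsub : A ∩ Set.Ioo 0 δ ⊆ Set.Icc (0 : ℝ) (1 : ℝ≥0) := fun s hs ↦
      ⟨hs.2.1.le, by simpa using (hs.2.2.le.trans (min_le_right _ _))⟩
    exact hAbig δ hδpos _ Set.Subset.rfl Set.inter_subset_left
      ((nullMeasurableSet_restrict_of_subset hsub).1 hnm)
  rw [ae_iff] at hconc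
  exact measure_brownian_one_pos_ne_zero (measure_mono_null (fun ω hω ↦ hfail ω hω) hconc)

end Literature.Analysis.FunctionSpaces
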